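import Summits.ResolutionOfSingularities.ResolutionOfSingularities.Theses.UniversalCells
import Literature.AlgebraicGeometry.Resolution.RegularLocalRingsJacobian
import HarnessLib

/-!
# `MatroidCellRes` — tightness: the conclusion cannot be strengthened to "`W` is regular"
# (an integral, singular stratum with five columns)

Support (negative) lemma for crux stmt-ResolutionOfSingularities-15230
(`Summit.ResolutionOfSingularities.ResolutionOfSingularities.Theses.UniversalCells.MatroidCellRes`,
route UniversalCells, rank 2: "every INTEGRAL scheme `W` open-immersed in a partial matroid stratum
`P(p,m,Γ₊,Γ₀)` over `𝔽_p` is pointwise-locally resolvable"), filed by the crux disprover (cdisprove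
seat, generation 2). This file declares no definition and no notation.

## Main statements

* `matroidCellRes_isRegular_strengthening_false` — the NATURAL STRENGTHENING of the crux in which
  the conclusion "every point has a resolvable neighbourhood" is replaced by "`W` is regular"
  (which implies it: `Scheme.IsRegular.hasResolution`) is FALSE;
  `matroidCellRes_isRegular_strengthening_false_at` — a witness at every prime `p`.
* The witness: `m = 2` (five columns `e₀ e₁ e₂ c₀ c₁`), `Γ₊ = ∅`, `Γ₀ = {(e₀, c₀, c₁)}`, whose
  minor is the quadric `q = a₁₀a₂₁ - a₁₁a₂₀` (`minor_e0c0c1`): the stratum is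
  `Spec 𝔽_p[a_ij : 3 × 2] ⧸ (q)` = (the three-dimensional ordinary double point) `× 𝔸²`, the
  strategist's `Z_{x₁₄₅}` (STRATEGY-CENSUS §5), the first SINGULAR integral Γ-scheme. It is
  integral: `q = a₁₀ · a₂₁ + (-a₁₁a₂₀)` is irreducible by Mathlib's
  `MvPolynomial.irreducible_mul_X_add` (`a₂₁` occurs in neither coefficient, and `a₁₀`,
  `a₁₁a₂₀` are relatively prime as `a₁₀` is prime), hence prime in the UFD `𝔽_p[a_ij]`
  (`prime_quadric`). It is singular at the origin: `q(0) = 0`, `∇q(0) = 0`, so the local ring at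
  the origin is not regular by the Jacobian criterion (singular direction, in tree:
  `Resolution.not_isRegularLocalRing_localization_of_pderiv_eval_eq_zero`, Hartshorne I 5.1 /
  Matsumura 14.2); `W := Spec (𝔽_p[a] ⧸ (q))`, open-immersed in (indeed isomorphic to) the stratum
  `Spec ((𝔽_p[a] ⧸ I)[(∏_∅)⁻¹])` by the localisation-at-`1` isomorphism.

## Reading for the provers / the route

The crux has genuinely SINGULAR integral instances already at five columns (`n = 5`), so it is not
closed by the landed regular-point stub (R) (`stub_regularPointLocalRes`, p148615) alone; resolving
this particular stratum is a calibration (blow up the vertex `𝔸²`; STRATEGY-CENSUS §5 / Hu 2025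
§4–§8 at `n = 5`), not done here. Companion negative lemmas: `IsIntegral` (p154216),
`IsOpenImmersion` (p149749) and, at stub level, chart integrality / `IsDomain`
(`SaturatedChartIntegralityLoadBearing`) are load-bearing.

Folklore (explicit computation; Hartshorne I Ex. 5.x for the quadric cone).
-/

noncomputable section

-- single-problem summit: the doubled namespace component `ResolutionOfSingularities` is forced
set_option linter.dupNamespace false

open CategoryTheory AlgebraicGeometry TopologicalSpace Literature.AlgebraicGeometry.Resolution
open MvPolynomial (X C)

namespace Summit.ResolutionOfSingularities.ResolutionOfSingularities.Theorems.MatroidCellRes.Negative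

/-! ## §1 The quadric minor and its primality -/

/-- For `m = 2`, the minor of `[I₃ | A]` on `(e₀, c₀, c₁)` is `a₁₀a₂₁ - a₁₁a₂₀`. [folklore] -/
theorem minor_e0c0c1 (p : ℕ) :
    ((Matrix.fromCols (1 : Matrix (Fin 3) (Fin 3) (MvPolynomial (Fin 3 × Fin 2) (ZMod p)))
        (Matrix.of fun i j => MvPolynomial.X (i, j))).submatrix id
          ![Sum.inl 0, Sum.inr 0, Sum.inr 1]).det =
      X (1,0) * X (2,1) - X (1,1) * X (2,0) := by
  simp [Matrix.det_fin_three, Matrix.submatrix_apply, Matrix.fromCols_apply_inl,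
    Matrix.fromCols_apply_inr]

/-- The quadric `a₁₀a₂₁ - a₁₁a₂₀` is a prime element of `𝔽_p[a_ij : 3 × 2]`: it is
`a₁₀ · a₂₁ + (-a₁₁a₂₀)` with `a₂₁` in neither coefficient and `a₁₀`, `-a₁₁a₂₀` relatively prime
(`MvPolynomial.irreducible_mul_X_add`), and irreducible is prime in a UFD. [folklore] -/
theorem prime_quadric (p : ℕ) [Fact p.Prime] :
    Prime (X (1,0) * X (2,1) - X (1,1) * X (2,0) : MvPolynomial (Fin 3 × Fin 2) (ZMod p)) := by
  classical
  have hX : Prime (X (1,0) : MvPolynomial (Fin 3 × Fin 2) (ZMod p)) := MvPolynomial.X_prime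
  have hirr : Irreducible
      (X (1,0) * X (2,1) + (-(X (1,1) * X (2,0))) : MvPolynomial (Fin 3 × Fin 2) (ZMod p)) := by
    refine MvPolynomial.irreducible_mul_X_add (X (1,0)) (-(X (1,1) * X (2,0))) (2,1)
      (MvPolynomial.X_ne_zero _) ?_ ?_ ?_
    · rw [MvPolynomial.vars_X]
      decide
    · rw [MvPolynomial.vars_neg]
      intro h
      have h' := MvPolynomial.vars_mul _ _ h
      rw [MvPolynomial.vars_X, MvPolynomial.vars_X] at h'
      revert h'
      decide
    · rw [hX.irreducible.isRelPrime_iff_not_dvd, dvd_neg]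
      intro hd
      rcases hX.dvd_or_dvd hd with h | h <;> rw [MvPolynomial.X_dvd_X] at h <;>
        exact absurd h (by decide)
  have e : (X (1,0) * X (2,1) - X (1,1) * X (2,0) : MvPolynomial (Fin 3 × Fin 2) (ZMod p)) =
      X (1,0) * X (2,1) + (-(X (1,1) * X (2,0))) := by ring
  rw [e]
  exact hirr.prime

/-! ## §2 The witness -/

/-- **At every prime `p`: an integral scheme open-immersed in the stratum `P(p, 2, ∅, {(e₀,c₀,c₁)})`
that is NOT regular** — the stratum itself, `Spec 𝔽_p[a_ij : 3 × 2] ⧸ (a₁₀a₂₁ - a₁₁a₂₀)`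
(ordinary threefold double point `× 𝔸²`), mapped isomorphically onto
`Spec ((𝔽_p[a] ⧸ I)[(∏_∅)⁻¹])` by the localisation at `1`; integral because the quadric is prime
(`prime_quadric`), singular at the origin by the Jacobian criterion
(`not_isRegularLocalRing_localization_of_pderiv_eval_eq_zero`: `q(0) = 0`, `∇q(0) = 0`), the
stalk of `Spec` at a prime being the localisation (`StructureSheaf.stalkIso`). [folklore] -/
theorem matroidCellRes_isRegular_strengthening_false_at (p : ℕ) (hp : p.Prime) :
    let M : Matrix (Fin 3) (Fin 3 ⊕ Fin 2) (MvPolynomial (Fin 3 × Fin 2) (ZMod p)) :=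
      Matrix.fromCols 1 (Matrix.of fun i j => MvPolynomial.X (i, j))
    let I : Ideal (MvPolynomial (Fin 3 × Fin 2) (ZMod p)) :=
      Ideal.span ((fun u : Fin 3 → Fin 3 ⊕ Fin 2 => (M.submatrix id u).det) ''
        ({![Sum.inl 0, Sum.inr 0, Sum.inr 1]} : Set (Fin 3 → Fin 3 ⊕ Fin 2)))
    ∃ (W : Scheme.{0})
      (i : W ⟶ Spec (.of (Localization.Away (Ideal.Quotient.mk I
        (∏ u ∈ (∅ : Finset (Fin 3 → Fin 3 ⊕ Fin 2)), (M.submatrix id u).det))))),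
      IsOpenImmersion i ∧ IsIntegral W ∧ ¬ Scheme.IsRegular W := by
  intro M I
  classical
  haveI : Fact p.Prime := ⟨hp⟩
  -- the ideal is `(q)`, `q` the prime quadric
  set q : MvPolynomial (Fin 3 × Fin 2) (ZMod p) := X (1,0) * X (2,1) - X (1,1) * X (2,0) with hqdef
  have hqprime : Prime q := prime_quadric p
  have hI : I = Ideal.span {q} := by
    show Ideal.span _ = _
    rw [Set.image_singleton]
    exact congrArg (fun t => Ideal.span {t}) (minor_e0c0c1 p)
  -- the witness `W = Spec (𝔽_p[a] ⧸ (q))` and the isomorphism onto the stratum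
  haveI hspan : (Ideal.span {q}).IsPrime := (Ideal.span_singleton_prime hqprime.ne_zero).mpr hqprime
  haveI : IsDomain (MvPolynomial (Fin 3 × Fin 2) (ZMod p) ⧸ Ideal.span {q}) :=
    Ideal.Quotient.isDomain _
  let r : MvPolynomial (Fin 3 × Fin 2) (ZMod p) ⧸ I :=
    Ideal.Quotient.mk I (∏ u ∈ (∅ : Finset (Fin 3 → Fin 3 ⊕ Fin 2)), (M.submatrix id u).det)
  have hr : r = 1 := by simp [r]
  let eL : (MvPolynomial (Fin 3 × Fin 2) (ZMod p) ⧸ I) ≃ₐ[MvPolynomial (Fin 3 × Fin 2) (ZMod p) ⧸ I]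
      Localization.Away r :=
    IsLocalization.atUnits _ (Submonoid.powers r) (by
      rintro y ⟨n, rfl⟩
      show IsUnit (r ^ n)
      rw [hr, one_pow]
      exact isUnit_one)
  let Φ : Localization.Away r ≃+* (MvPolynomial (Fin 3 × Fin 2) (ZMod p) ⧸ Ideal.span {q}) :=
    eL.symm.toRingEquiv.trans (Ideal.quotEquivOfEq hI)
  refine ⟨Spec (.of (MvPolynomial (Fin 3 × Fin 2) (ZMod p) ⧸ Ideal.span {q})),
    Spec.map Φ.toCommRingCatIso.hom, inferInstance, inferInstance, ?_⟩
  -- the origin is a singular point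
  intro hreg
  let K₀ : Ideal (MvPolynomial (Fin 3 × Fin 2) (ZMod p)) :=
    RingHom.ker (MvPolynomial.eval fun _ : Fin 3 × Fin 2 => (0 : ZMod p))
  haveI : K₀.IsPrime := RingHom.ker_isPrime _
  have hq0 : MvPolynomial.eval (fun _ : Fin 3 × Fin 2 => (0 : ZMod p)) q = 0 := by
    simp [hqdef]
  have hq1 : ∀ i, MvPolynomial.eval (fun _ : Fin 3 × Fin 2 => (0 : ZMod p))
      (MvPolynomial.pderiv i q) = 0 := by
    intro i
    simp only [hqdef, map_sub, Derivation.leibniz, MvPolynomial.pderiv_X, smul_eq_mul, map_add,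
      map_mul, MvPolynomial.eval_X, zero_mul, add_zero, sub_self]
  have hqK : q ∈ K₀ := hq0
  have hle : Ideal.span {q} ≤ K₀ := by
    rw [Ideal.span_le, Set.singleton_subset_iff]
    exact hqK
  haveI hPprime : (K₀.map (Ideal.Quotient.mk (Ideal.span {q}))).IsPrime :=
    Ideal.map_isPrime_of_surjective Ideal.Quotient.mk_surjective (by rwa [Ideal.mk_ker])
  let x : PrimeSpectrum (MvPolynomial (Fin 3 × Fin 2) (ZMod p) ⧸ Ideal.span {q}) :=
    ⟨K₀.map (Ideal.Quotient.mk (Ideal.span {q})), hPprime⟩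
  have hcomap : x.asIdeal.comap (Ideal.Quotient.mk (Ideal.span {q})) = K₀ := by
    show (K₀.map (Ideal.Quotient.mk (Ideal.span {q}))).comap _ = K₀
    rw [Ideal.comap_map_of_surjective _ Ideal.Quotient.mk_surjective, ← RingHom.ker_eq_comap_bot,
      Ideal.mk_ker]
    exact sup_eq_left.mpr hle
  -- the stalk at `x` is regular by assumption, and is the localisation at `x`
  have hreg1 : IsRegularLocalRing
      ((Spec (.of (MvPolynomial (Fin 3 × Fin 2) (ZMod p) ⧸ Ideal.span {q}))).presheaf.stalk x) :=
    hreg x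
  haveI hreg2 : IsRegularLocalRing ((structurePresheafInCommRingCat
      (MvPolynomial (Fin 3 × Fin 2) (ZMod p) ⧸ Ideal.span {q})).stalk x) := hreg1
  haveI hreg3 : IsRegularLocalRing (Localization.AtPrime x.asIdeal) :=
    IsRegularLocalRing.of_ringEquiv (StructureSheaf.stalkIso _ x).toRingEquiv.symm
  exact not_isRegularLocalRing_localization_of_pderiv_eval_eq_zero (fun _ => (0 : ZMod p))
    hqprime.ne_zero hq0 hq1 x.asIdeal hcomap hreg3

/-- **The crux's conclusion cannot be strengthened to regularity of `W`.** The statement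
"for every prime `p`, every `m`, `Γ₊`, `Γ₀`, every INTEGRAL scheme `W` open-immersed in the partial
matroid stratum `P(p,m,Γ₊,Γ₀)` is REGULAR" (which would give `MatroidCellRes` at once, every regular
scheme being its own resolution) is FALSE: at `p = 2` (indeed at every prime,
`matroidCellRes_isRegular_strengthening_false_at`), `m = 2`, `Γ₊ = ∅`, `Γ₀ = {(e₀,c₀,c₁)}` the
stratum `{a₁₀a₂₁ = a₁₁a₂₀} ⊂ 𝔸⁶` is integral and singular along `{a₁₀ = a₁₁ = a₂₀ = a₂₁ = 0}`.
The universal family has singular integral members already at FIVE columns; the crux is not the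
regular-point stub (R) in disguise. [folklore] -/
theorem matroidCellRes_isRegular_strengthening_false :
    ¬ ∀ p : ℕ, p.Prime → ∀ (m : ℕ) (Γp : Finset (Fin 3 → Fin 3 ⊕ Fin m))
        (Γ0 : Set (Fin 3 → Fin 3 ⊕ Fin m)),
      let M : Matrix (Fin 3) (Fin 3 ⊕ Fin m) (MvPolynomial (Fin 3 × Fin m) (ZMod p)) :=
        Matrix.fromCols 1 (Matrix.of fun i j => MvPolynomial.X (i, j))
      let I : Ideal (MvPolynomial (Fin 3 × Fin m) (ZMod p)) :=
        Ideal.span ((fun u : Fin 3 → Fin 3 ⊕ Fin m => (M.submatrix id u).det) '' Γ0)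
      ∀ (W : Scheme.{0})
        (i : W ⟶ Spec (.of (Localization.Away (Ideal.Quotient.mk I
          (∏ u ∈ Γp, (M.submatrix id u).det))))),
        IsOpenImmersion i → IsIntegral W → Scheme.IsRegular W := by
  intro H
  obtain ⟨W, i, hi, hint, hnot⟩ := matroidCellRes_isRegular_strengthening_false_at 2 Nat.prime_two
  exact hnot (H 2 Nat.prime_two 2 ∅ _ W i hi hint)

end Summit.ResolutionOfSingularities.ResolutionOfSingularities.Theorems.MatroidCellRes.Negative

end
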